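import Mathlib
import HarnessLib
import HarnessLib.Audit
import Summits.Langlands.Statement
import HarnessLib.Audit.Status.Attr

/-!
Route: EisensteinDegreeShift

DORMANT since 2026-08-25T10:55:34Z (reconciler: no traction for 7.6 d (last activity item-evidence-added at 2026-08-17T19:12:31Z); parked, not closed — `ledger route dormant route-Langlands-EisensteinDegreeShift --off` to reactivate) — unstaffed, not closed; items shared with open routes are served there. `ledger route dormant <id> --off` reactivates.

# Route EisensteinDegreeShift — Eisenstein-tolerant degree shifting turns residually Borel
Fontaine–Laffaille reciprocity over CM fields into a seeded lifting problem

OPEN-QUESTION HARVEST (lens oqh, cycle 3). A'Campo–Hevesi–Thorne–Whitmore (arXiv:2607.11763, July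
2026) prove torsion local–global
compatibility at p for GL_n over CM fields at ARBITRARY maximal ideals of the Hecke algebra (Prop.
5.2.8, p. 75; Thm. 2.5.7: a quantitative
vanishing theorem replacing Caraiani–Scholze without the decomposed-generic condition) and print the
aim (§1.3, pp. 7–8): "with the aim of
proving e.g. R = T theorems under more degenerate conditions than the ones considered in [ACC+23] …
instead of proving the expected result
'up to a nilpotent ideal', we are able to prove a result 'up to bounded T_w-torsion'"; p. 77:
"relaxing the residual irreducibility
condition … in any of the listed articles, results are only proved after localisation at a
non-Eisenstein maximal ideal". The route takes
that printed aim as its deciding crux on the one sector of direction (B) where residual automorphy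
is FREE — residually BOREL ρ̄ — and no
open route lives: TARGET BorelFLReciprocity = clause (B) in Satake form for K CM, 2 ≤ n < p, p
unramified in K, ρ irreducible, a.e.
unramified, residually upper triangular, crystalline above p with distinct labelled Hodge–Tate
weights in a Fontaine–Laffaille interval.
It suffices to show X = EisensteinSteinbergSeed ∧ EisensteinSeededLifting (∧ the printed
soluble-descent support SolubleDescentGLn):
(S1) after a soluble CM base change, ρ acquires a CUSPIDAL seed — a cuspidal π₀ congruent to ρ on
the residual diagonal, of the same labelled
weights, Steinberg at an auxiliary place v₀; (S2) such a seed lifts: ρ is automorphic (the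
Eisenstein-localised R = T of the printed aim);
(S3) automorphy descends. X → Langlands is the declared residual junction SectorComplement. No idea
card is realised.
Lean: `EisensteinSteinbergSeed ∧ EisensteinSeededLifting`

## Assembly
Pure logic, certified in glue.lean (kernel-checked in Sketch.lean, rc 0, 0 sorries): `closes (h₁ :
EisensteinSteinbergSeed) (h₂ :
EisensteinSeededLifting) (h₃ : SolubleDescentGLn) (hC : SectorComplement) : Langlands := hC
(target)`, the target derived inline: fix the
sector data (K, n, p, O, hcpt, ι, ρ, ρ₀, hypotheses); h₁ gives K', its instances, solubility,
CM-ness, unramifiedness of p, the model ρ₀', the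
sector hypotheses for ρ|K', the place v₀ and the seed core; h₂ at (K', ρ|K', ρ₀') with the seed ⟨v₀,
…⟩ gives a cuspidal π' over K'; h₃
descends it to K. Every hypothesis of closes is a declared item; the load-bearing open cruxes are
S1, S2 and the residual junction (S3 is a
printed support). The Assembly item records the literal type of `closes`.

Rationale: WHY THIS LINE. Residually reducible automorphy lifting is defect zero in print (SkinnerWiles1999
totally real ordinary; Pan2022 over ℚ via p-adic local
Langlands; Thorne2015 / AllenNewtonThorne2020 = doi:10.1112/S0010437X20007484 polarizable ordinary
with a Steinberg place), and every
positive-defect theorem over CM fields (arXiv:1812.09999 Thm. 6.1.1, arXiv:2301.10509 Thm. 1.3,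
Qian2022) localises at a NON-EISENSTEIN
maximal ideal because the torsion local–global compatibility it patches with was only available
there. arXiv:2607.11763 removes exactly that
restriction (Galois-type determinants with LGC at p modulo bounded T_n·p^N-torsion at any 𝔪, §3
potentially semistable pseudodeformation rings
for arbitrary residual representations, §5.3 torsion Eisenstein series in boundary cohomology), so
the Calegari–Geraghty/ACC+ patching of
complexes can for the first time be run at an Eisenstein 𝔪 of GL_n over a CM field: imported areas
are Wang-Erickson/Wake–Wang-Erickson
pseudodeformation theory with conditions, Thorne's Steinberg-seed control of the reducible locus,
Eisenstein cohomology / level raising from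
the Borel–Serre boundary (Harder, Berger2009) for the seed, and Arthur–Clozel soluble base change
for set-up and descent. Nearest routes:
SkinnerWilesDefectOne (n = 2, imaginary quadratic, ORDINARY, Λ-adic Skinner–Wiles with a
Taylor–Steinberg pin), SiegelEisensteinFern (ordinary,
any residual image, infinite-fern lever), NewtonPatching / StickelbergerDial (residually absolutely
irreducible): none touches rank n ≥ 3 or the
non-ordinary Fontaine–Laffaille range at a reducible ρ̄, and none uses the 2026 Eisenstein-tolerant
degree shifting. Negatives index (4
entries: SplitPrimeInduction ×2, OrdinaryPrimeTransport pole count, K3 anchor) is unrelated.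

RANKED CRUXES. #0 BorelFLReciprocity (target) — Clause (B) of the summit, Satake form, on the
sector: for K CM, 2 ≤ n < p, p unramified in K, O the valuation ring of ℚ̄_p, every irreducible ρ :
Γ_K → GL_n(ℚ̄_p) that is unramified a.e., admits a residually upper-triangular integral model ρ₀
over O, and is crystalline at every v ∣ p for Fontaine's pinned datum with n distinct τ-labelled
Hodge–Tate weights lying in an interval of length ≤ p − 2 (every τ), is Satake–Frobenius compatible
at almost all places with an L-algebraic cuspidal π of GL_n(𝔸_K). (why it might fail: It is
Fontaine–Mazur–Langlands on a sector (false only if FM fails); typed risks: the L-normalisation of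
SatakeFrobCompatibleAt, the pinned-datum crystalline clause, emptiness of τ's for a junk datum (same
idiom as TriangulineChamber, accepted).) [FontaineMazurGeometric1995, BuzzardGeeLMS2014,
arXiv:2607.11763, SkinnerWiles1999, arXiv:1812.09999]
#2 EisensteinSeededLifting (crux) — PRINTED AIM (arXiv:2607.11763 §1.3 pp. 7–8, p. 77):
Eisenstein-seeded automorphy lifting. Same sector as the target PLUS a cuspidal seed — an auxiliary
place v₀ ∤ p at which ρ is unramified, and a cuspidal L-algebraic π₀ on GL_n(𝔸_K) with an
irreducible p-adic avatar ρ₁ (Satake a.e.) that has a residually upper-triangular integral model ρ₁₀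
with the SAME residual diagonal entries as ρ₀ (all g, all i), is crystalline above p with the SAME
labelled Hodge–Tate weights as ρ, and is of Steinberg type at v₀ (a Weil–Deligne representation of
ρ₁|K_v₀ with N^(n-1) ≠ 0) — THEN ρ is Satake–Frobenius compatible a.e. with an L-algebraic cuspidal
π. Intended proof: big R^ps = 𝕋_𝔪 at the Eisenstein maximal ideal 𝔪 of the seed by
Calegari–Geraghty/ACC+ patching of the GL_n/K complexes over the Wake–Wang-Erickson/AHTW
potentially-crystalline pseudodeformation ring, Thorne's Steinberg place emptying the reducible
locus in characteristic 0, Taylor's Ihara avoidance at v₀, the Galois input being AHTW Prop. 5.2.8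
(LGC mod bounded T_n p^N-torsion at any 𝔪). [difficulty: open-problem] (why it might fail: AHTW p.7
give LGC only 'up to bounded T_w-torsion', maybe too weak to patch; reducible FL locus of χ̄₁⊕…⊕χ̄_n
over CM has positive-dimensional H¹_f strata (SW99: 'dimension grows with Σ') with no Λ-adic margin
off ordinary; TW primes for Borel ρ̄ (ANT2020 needs Schur + ordinary).) [arXiv:2607.11763,
arXiv:1812.09999, doi:10.1112/S0010437X20007484, SkinnerWiles1999, arXiv:2301.10509,
CalegariGeraghty2017, WakeWangErickson2021]
#3 EisensteinSteinbergSeed (crux) — THE ENTRANCE (Ribet/Skinner–Wiles step for GL_n over CM): for ρ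
in the sector there is a finite Galois extension K'/K with soluble Galois group, K' CM, p unramified
in K', such that ρ|K' is still irreducible and in the sector (a.e. unramified, residually
upper-triangular integral model ρ₀', crystalline Fontaine–Laffaille with distinct labelled weights),
together with a place v₀ ∤ p of K' where ρ|K' is unramified and a cuspidal seed over K' exactly as
in EisensteinSeededLifting (cuspidal L-algebraic π₀ on GL_n(𝔸_K'), irreducible avatar ρ₁ with the
same residual diagonal as ρ₀', same labelled weights as ρ|K', Steinberg type at v₀). Intended proof:
Chebotarev set-up (v₀ with q ≡ 1 mod p and ρ̄(Frob) unipotent, soluble CM base change keeping p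
unramified), then an Eisenstein-to-cuspidal congruence Steinberg at v₀ in the weight of ρ — level
raising from the Borel–Serre boundary (torsion Eisenstein classes, AHTW §5.3; Harder's Eisenstein
cohomology; Berger2009 for n = 2 imaginary quadratic; automorphic induction of characters for
cyclically-shaped diagonals). [difficulty: XL] (why it might fail: Eisenstein congruences in a
PRESCRIBED regular weight with a Steinberg place are known only for GL₂ (Ribet, Berger2009 needs p |
L-value); for general (χ̄_i) the boundary class may not lift to a cuspidal one of the same weight;
keeping p unramified in K' restricts the SW-style base changes.) [Berger2009, SkinnerWiles1999,
arXiv:2607.11763, Harder1987, Ribet1976, ArthurClozelAMS120]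
#9 SolubleDescentGLn (support) — Soluble descent given the Galois representation (printed:
Arthur–Clozel cyclic base change + strong multiplicity one + Chebotarev, the BLGGT/ACC+ descent
lemma): K'/K finite Galois with soluble group, K and K' CM, ρ : Γ_K → GL_n(ℚ̄_p) irreducible with
ρ|K' irreducible and Satake–Frobenius compatible a.e. with an L-algebraic cuspidal π' of GL_n(𝔸_K')
⟹ ρ is Satake–Frobenius compatible a.e. with an L-algebraic cuspidal π of GL_n(𝔸_K). Every
intermediate field is CM (complex conjugation is central in Aut of a CM field), so HLTT
representations exist along the tower. [difficulty: L] [ArthurClozelAMS120, arXiv:1812.09999,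
BarnetlambEtAl2014, HarrisLanTaylorThorneRMS2016]
#9 SectorComplement (crux) — THE REST OF THE SUMMIT along this line (declared RESIDUAL junction,
sector convention of DyadicOddResidue / FifteenLocusEisenstein / SkinnerWilesDefectOne):
BorelFLReciprocity → Langlands — direction (A) entirely, local–global compatibility at every finite
place, direction (B) off the sector (residually irreducible ρ̄, ordinary/non-FL weights, p ramified
or small, n ≥ p, non-CM fields, irregular weights), the reciprocity data. Conjecture-grade, implied
by the summit (probe: S → SectorComplement holds), never staffed from this route. [deps:
BorelFLReciprocity] [difficulty: open-problem] (why it might fail: It IS global Langlands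
reciprocity for GL_n outside one sector (BuzzardGeeLMS2014 Conj. 3.2.1/3.2.2,
FontaineMazurGeometric1995 Conj. 1): even Galois representations, irregular π, non-CM fields are all
inside it; declared residual, graders judge S1/S2.) [BuzzardGeeLMS2014, FontaineMazurGeometric1995,
arXiv:2607.11763]

TWO-LAYER PLAN. Foreseen glued splits = the BC3 birth skeletons (compositions proved,
bc/*_birth.lean rc 0), none filed now: (i) EisensteinSeededLifting ⇐
SeedClassTransport (upgrade a seed with the right residual DIAGONAL to one with the right residual
EXTENSION CLASS — Ribet/Skinner–Wiles
lattice transport in rank n) → LiftingSameResidual (seeded lifting for a fixed non-semisimple Borel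
ρ̄, where Mazur's functor is representable
for generic extension classes) → EisensteinSeededLifting. (ii) EisensteinSteinbergSeed ⇐
ChebotarevSetup (soluble CM base change with p
unramified + a place v₀, q_v₀ ≡ 1 mod p, ρ̄(Frob_v₀) unipotent) → EisensteinLevelRaising (cuspidal
congruence Steinberg at v₀ in the weight
of ρ) → EisensteinSteinbergSeed. (iii) Later inside (i): ordinary-at-p versus genuinely non-ordinary
Fontaine–Laffaille, if the Λ-adic margin
is needed after all.

KILL CRITERIA. A proof in print of residually-reducible non-polarizable automorphy lifting over CM
fields in the Fontaine–Laffaille range closes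
EisensteinSeededLifting as a cite (run `lit citing arxiv:2607.11763` first; the companion AHTW26 on
adjoint Selmer groups is not it). A
refutation can only be (a) a MISSTATEMENT of a typed clause (L-normalisation of
SatakeFrobCompatibleAt; the pinned crystalline clause; the
residual-diagonal congruence allowing a permutation mismatch; `r.N ^ (n-1)` for a junk WD witness) —
repair by restating along the accepted
SkinnerWilesDefectOne / NewtonPatching renderings and re-certify; or (b) an irreducible, residually
Borel, crystalline FL-regular ρ over a CM
field that is provably non-automorphic — that refutes Fontaine–Mazur itself: close `refuted:<Decl>`
and file the witness in BARRIERS.md. If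
the seed's 'same diagonal' turns out too weak for any lifting theorem (extension-class obstruction
essential), pivot S2 to the
same-residual form (stub_liftingSameResidual) and move the class transport into S1.

NOT DECOMPOSED YET. The ordinary / non-ordinary cut of S2; the Taylor–Wiles-prime supply for Borel
ρ̄ in rank n (a lemma under S2, rides with --supports); the
exact 'LGC modulo bounded torsion suffices for patching' statement (AHTW Prop. 5.2.8 as a cite item,
to be filed); the boundary-to-cuspidal
lifting lemma in a prescribed weight (under S1); the junction (never decomposed here); a Literature
fact for the soluble-descent support.

CHEAPEST FALSIFIER. (1) Literature first: `lit citing arxiv:2607.11763` (run 2026-08-17: too new, 0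
local citers), `lit search "residually reducible"
automorphy lifting --year-from 2019` (20 local + 20 remote rows: nothing non-polarizable over CM
beyond GL₂ imaginary quadratic special
cases BergerKlosin/Akers2025 and totally real arXiv:2411.18661, arXiv:2512.21249). (2) Consistency
on the known locus (refuter, pen and
paper): ρ = ρ_E,5|Γ_K for E/ℚ with a rational 5-isogeny (e.g. 11a1) and K = ℚ(√−1) or ℚ(√−2): every
typed hypothesis of
BorelFLReciprocity holds (n = 2 < 5, 5 unramified, weights {0,1}, residually Borel) and the
conclusion holds by base change of the modular
form — checks the normalisations. (3) n = 2, K imaginary quadratic, p split: compare S2 with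
BergerKlosin2011/2013 R = T hypotheses (the BC5
rung). (4) `lean check` of Sketch.lean (rc 0) and the BC2/BC7 probes (all fail / CLEAN as required).

NUMBERS. Residually reducible lifting in print: GL₂/ℚ all p ≥ 3 regular (Pan2022 +
SkinnerWiles1999), GL₂/totally real ordinary with abelian
restrictions (SkinnerWiles1999; arXiv:2411.18661 abelian F, p split), GL_n polarizable ordinary
Schur + Steinberg (Thorne2015, ANT2020:
doi:10.1112/S0010437X20007484), GL₂/imaginary quadratic special Eisenstein data
(BergerKlosin2009/2011/2013, Akers2025). Non-polarizable
GL_n over CM, n ≥ 3 or non-ordinary: nothing. AHTW torsion LGC exponent: (T_n² p^N₂ J)^N₁ = 0 with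
N₁, N₂ depending only on n, F and the
local system (Prop. 5.2.8, Thm. 5.2.9 proof p. 76).

DEFINITION REQUESTS. Cite items to file after open: `fact: AHTW2026 Prop. 5.2.8 (torsion LGC at
arbitrary maximal ideals, GL_n/CM)`, `fact: AHTW2026 Thm. 2.5.7
(quantitative vanishing below middle degree)`, `fact: AllenNewtonThorne2020 Thm. 1.1`, `fact:
BLGGT-type soluble descent for CM fields`
(discharges SolubleDescentGLn from ArthurClozelAMS120 + HLTT). No new notion needed (all items typed
over OrdinaryGaloisRep,
CrystallineDeformationRing, LabelledHodgeTateWeights, FontaineDpst and the Statement).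

Novelty: Searches (2026-08-17): corpus frontier.json (60 rows since 2023), reads.jsonl (5), galaxy.json (30),
new.md (37 works), questions.tsv (108 rows), nearmiss.md; page-level reads arXiv:2607.11763 pp. 1–8,
65–78 (Prop. 5.2.8, Thm. 5.2.9, Rem. 5.2.10, §5.3 head); arXiv:2603.19768 pp. 3–4 (+grep 85 hits);
arXiv:2605.03519 (grep, chunk 3); arXiv:2603.02014 (grep); arXiv:2212.03595 p. 3; arXiv:2411.18661
(grep 41 hits); arXiv:2301.10509 pp. 4–5 (+grep 42 hits); arXiv:2607.25889 (grep); 92 Theses headers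
of the sub read; `lit search "residually reducible" automorphy lifting --year-from 2019` (20+20);
`lit search --hybrid "Eisenstein ideal torsion cohomology GL_n CM field reducible …"` (15); `lit
search` ×3 title look-ups; `lean search` (HasUpperTriangularIntegralModel, IsCrystallineFramed,
labelledHodgeTateWeightsAt, fontainePstAdicCompletion, restrictField, IsPolarizable — none
Galois-side); `ledger negatives --problem Langlands` (4, unrelated); OpenAlex/S2 rate-limited (429)
— tribunal should re-run `lit citing arxiv:2607.11763`; galaxy not queried this cycle for 2026
preprints (previous cycle: 0 hits for 2026 papers).
Nearest prior art found: SkinnerWiles1999 (GL₂ totally real ordinary, Λ-adic pseudo-deformations);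
doi:10.1112/S0010437X20007484 = AllenNewtonThorne2020 (polarizable, ordinary, Schur ρ̄, Steinberg
place); arXiv:2607.11763 (the enabling Eisenstein-tolerant torsion LGC, no lifting theorem); in the
hub route-Langlands-SkinnerWilesDefectOne (n = 2 imaginary quadratic ordi  [refs: 10.1112/S0010437X20007484, 2607.11763, 2603.19768, 2605.03519, 2603.02014, 2212.03595, 2411.18661, 2301.10509, 2607.25889, arxiv:2607.11763, doi:10.1112/S0010437X20007484, SkinnerWiles1999, AllenNewtonThorne2020]

Barriers (technique_class: taylor-wiles calegari-geraghty pseudodeformation eisenstein): - technique_class: taylor-wiles, calegari-geraghty, pseudodeformation, eisenstein-congruence,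
soluble-base-change
- Literature.Barriers.Langlands.ResiduallyReducibleBarrier: S2 sits INSIDE the Taylor–Wiles/patching
class and meets the NARROW record (`ResiduallyReducibleBarrierNarrow`: the Čebotarev/dual-Selmer
step for reducible ρ̄) head-on; evasion = the record's own evasions (c) and the WWE line: a
Steinberg SEED (Thorne2015/ANT2020: the Steinberg place empties the reducible locus in
characteristic 0), pseudodeformation rings with p-adic Hodge conditions for an ARBITRARY residual
representation (arXiv:2607.11763 §3, WakeWangErickson2021), patching complexes rather than modules;
the record itself prints "still open in print is general rank over general F without ordinarity" —
that is S2, declared open-problem, not claimed cheap.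
- Literature.Barriers.Langlands.TaylorWilesNumericalCoincidence: inside (l₀ > 0 over CM); evaded as
in arXiv:1812.09999 / CalegariGeraghty2017 by patching complexes in the range [q₀, q₀ + l₀] with
torsion Galois representations — now available at Eisenstein 𝔪 by arXiv:2607.11763 Prop. 5.2.8.
- Literature.Barriers.Langlands.TaylorWilesNumericalCoincidenceNarrow: inside (β): K CM and ρ
non-polarizable ⇒ no single-degree patching; evaded exactly as arXiv:1812.09999 Thm. 6.1.1 /
CalegariGeraghty2017 do — patch COMPLEXES over the range [q₀, q₀ + l₀] with torsion Galois
determinants, which arXiv:2607.11763 Prop. 5.2.8 now supplies at an Eisenstein maximal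

History (route lifecycle, newest last):
- 2026-08-25T10:55:34Z · DORMANT — reconciler: no traction for 7.6 d (last activity item-evidence-added at 2026-08-17T19:12:31Z); parked, not closed — `ledger route dormant route-Langlands-Eisens (operator:999:2030342)

sub-problem: Langlands · status: dormant · opened planner-plan-lens3-Langlands-oqh-g3-0 2026-08-17T15:10:04Z · rev 1 · ledger route-Langlands-EisensteinDegreeShift
GENERATED by the gate from the ledger (D-0016/17). Provers cite these decls: `theorem foo : Summit.Langlands.Langlands.Theses.EisensteinDegreeShift.<Decl> := …` in Summits/Langlands/Langlands/Theorems/<Name>.lean.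
-/

namespace Summit.Langlands.Langlands.Theses.EisensteinDegreeShift

open scoped BigOperators Topology Manifold Classical MeasureTheory ProbabilityTheory Matrix InnerProductSpace ComplexConjugate ContinuousMap
open Filter Set Function TopologicalSpace MeasureTheory

attribute [summit_statement] _root_.Langlands

/-- item stmt-Langlands-18368 · target · rank 0 · open · by planner
why it might fail: It is Fontaine–Mazur–Langlands on a sector (false only if FM fails); typed risks: the L-normalisation of SatakeFrobCompatibleAt, the pinned-datum crystalline clause, emptiness of τ's for a junk datum (same idiom as TriangulineChamber, accepted).
sources: FontaineMazurGeometric1995, BuzzardGeeLMS2014, arXiv:2607.11763, SkinnerWiles1999, arXiv:1812.09999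
[target] Clause (B) of the summit, Satake form, on the sector: for K CM, 2 ≤ n < p, p unramified in
K, O the valuation ring of ℚ̄_p, every irreducible ρ : Γ_K → GL_n(ℚ̄_p) that is unramified a.e.,
admits a residually upper-triangular integral model ρ₀ over O, and is crystalline at every v ∣ p for
Fontaine's pinned datum with n distinct τ-labelled Hodge–Tate weights lying in an interval of length
≤ p − 2 (every τ), is Satake–Frobenius compatible at almost all places with an L-algebraic cuspidal
π of GL_n(𝔸_K). -/
@[route_item "route-Langlands-EisensteinDegreeShift"]
def BorelFLReciprocity : Prop :=
  ∀ (K : Type) [Field K] [NumberField K], NumberField.IsCMField K → ∀ (n : ℕ), 2 ≤ n → ∀ (p : ℕ) [Fact p.Prime], n < p → (∀ v : IsDedekindDomain.HeightOneSpectrum ((NumberField.RingOfIntegers K)), ((p : ℕ) : (NumberField.RingOfIntegers K)) ∈ v.asIdeal → ¬ v.asIdeal ^ 2 ∣ Ideal.span {((p : ℕ) : (NumberField.RingOfIntegers K))}) → ∀ (O : ValuationSubring (PadicAlgCl p)), O = (Valued.v : Valuation (PadicAlgCl p) NNReal).valuationSubring → ∀ (hcpt : Literature.NumberTheory.Automorphic.isCompact_glFiniteIntegralLevel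 n K) (ι : PadicAlgCl p ≃+* ℂ) (ρ : Literature.NumberTheory.GaloisRepresentations.FramedGaloisRep K (PadicAlgCl p) n) (ρ₀ : Field.absoluteGaloisGroup K →* GL (Fin n) O), ρ.toGaloisRep.IsIrreducible → (∀ᶠ v : IsDedekindDomain.HeightOneSpectrum ((NumberField.RingOfIntegers K)) in Filter.cofinite, ρ.IsUnramifiedAt v) → ρ.HasUpperTriangularIntegralModel ρ₀ → (∀ (v : IsDedekindDomain.HeightOneSpectrum ((NumberField.RingOfIntegers K))) (hv : ((p : ℕ) : (NumberField.RingOfIntegers K)) ∈ v.asIdeal), let D := Literature.NumberTheory.PAdicHodge.fontainePstAdicCompletion v p hv; D.IsCrystallineFramed (ρ.toLocal v) ∧ (letI := D.algebra; ∀ τ : v.adicCompletion K →ₐ[ℚ_[p]] PadicAlgCl p, let M := ρ.labelledHodgeTateWeightsAt v D.algebra D.𝔅 τ.toRingHom; M.Nodup ∧ Multiset.card M = n ∧ ∀ a ∈ M, ∀ b ∈ M, a - b ≤ (p : ℤ) - 2)) → ∃ π : Literature.NumberTheory.Automorphic.CuspidalAutomorphicRepData n K hcpt, π.1.IsLAlgebraic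 ∧ ∀ᶠ v : IsDedekindDomain.HeightOneSpectrum ((NumberField.RingOfIntegers K)) in Filter.cofinite, Summit.Langlands.SatakeFrobCompatibleAt ι π.1 ρ v

/-- item stmt-Langlands-18369 · crux · rank 2 · open · by planner
why it might fail: AHTW p.7 give LGC only 'up to bounded T_w-torsion', maybe too weak to patch; reducible FL locus of χ̄₁⊕…⊕χ̄_n over CM has positive-dimensional H¹_f strata (SW99: 'dimension grows with Σ') with no Λ-adic margin off ordinary; TW primes for Borel ρ̄ (ANT2020 needs Schur + ordinary).
sources: arXiv:2607.11763, arXiv:1812.09999, doi:10.1112/S0010437X20007484, SkinnerWiles1999, arXiv:2301.10509, CalegariGeraghty2017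
[crux] PRINTED AIM (arXiv:2607.11763 §1.3 pp. 7–8, p. 77): Eisenstein-seeded automorphy lifting.
Same sector as the target PLUS a cuspidal seed — an auxiliary place v₀ ∤ p at which ρ is unramified,
and a cuspidal L-algebraic π₀ on GL_n(𝔸_K) with an irreducible p-adic avatar ρ₁ (Satake a.e.) that
has a residually upper-triangular integral model ρ₁₀ with the SAME residual diagonal entries as ρ₀
(all g, all i), is crystalline above p with the SAME labelled Hodge–Tate weights as ρ, and is of
Steinberg type at v₀ (a Weil–Deligne representation of ρ₁|K_v₀ with N^(n-1) ≠ 0) — THEN ρ is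
Satake–Frobenius compatible a.e. with an L-algebraic cuspidal π. Intended proof: big R^ps = 𝕋_𝔪 at
the Eisenstein maximal ideal 𝔪 of the seed by Calegari–Geraghty/ACC+ patching of the GL_n/K
complexes over the Wake–Wang-Erickson/AHTW potentially-crystalline pseudodeformation ring, Thorne's
Steinberg place emptying the reducible locus in characteristic 0, Taylor's Ihara avoidance at v₀,
the Galois input being AHTW Prop. 5.2.8 (LGC mod bounded T_n p^N-torsion at any 𝔪). [difficulty:
open-problem] -/
@[route_item "route-Langlands-EisensteinDegreeShift", crux]
def EisensteinSeededLifting : Prop :=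
  ∀ (K : Type) [Field K] [NumberField K], NumberField.IsCMField K → ∀ (n : ℕ), 2 ≤ n → ∀ (p : ℕ) [Fact p.Prime], n < p → (∀ v : IsDedekindDomain.HeightOneSpectrum ((NumberField.RingOfIntegers K)), ((p : ℕ) : (NumberField.RingOfIntegers K)) ∈ v.asIdeal → ¬ v.asIdeal ^ 2 ∣ Ideal.span {((p : ℕ) : (NumberField.RingOfIntegers K))}) → ∀ (O : ValuationSubring (PadicAlgCl p)), O = (Valued.v : Valuation (PadicAlgCl p) NNReal).valuationSubring → ∀ (hcpt : Literature.NumberTheory.Automorphic.isCompact_glFiniteIntegralLevel n K) (ι : PadicAlgCl p ≃+* ℂ) (ρ : Literature.NumberTheory.GaloisRepresentations.FramedGaloisRep K (PadicAlgCl p) n) (ρ₀ : Field.absoluteGaloisGroup K →* GL (Fin n) O), ρ.toGaloisRep.IsIrreducible → (∀ᶠ v : IsDedekindDomain.HeightOneSpectrum ((NumberField.RingOfIntegers K)) in Filter.cofinite, ρ.IsUnramifiedAt v) → ρ.HasUpperTriangularIntegralModel ρ₀ → (∀ (v : IsDedekindDomain.HeightOneSpectrum ((NumberField.RingOfIntegers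 K))) (hv : ((p : ℕ) : (NumberField.RingOfIntegers K)) ∈ v.asIdeal), let D := Literature.NumberTheory.PAdicHodge.fontainePstAdicCompletion v p hv; D.IsCrystallineFramed (ρ.toLocal v) ∧ (letI := D.algebra; ∀ τ : v.adicCompletion K →ₐ[ℚ_[p]] PadicAlgCl p, let M := ρ.labelledHodgeTateWeightsAt v D.algebra D.𝔅 τ.toRingHom; M.Nodup ∧ Multiset.card M = n ∧ ∀ a ∈ M, ∀ b ∈ M, a - b ≤ (p : ℤ) - 2)) → (∃ v₀ : IsDedekindDomain.HeightOneSpectrum ((NumberField.RingOfIntegers K)), ((p : ℕ) : (NumberField.RingOfIntegers K)) ∉ v₀.asIdeal ∧ ρ.IsUnramifiedAt v₀ ∧ ∃ (π₀ : Literature.NumberTheory.Automorphic.CuspidalAutomorphicRepData n K hcpt) (ρ₁ : Literature.NumberTheory.GaloisRepresentations.FramedGaloisRep K (PadicAlgCl p) n) (ρ₁₀ : Field.absoluteGaloisGroup K →* GL (Fin n) O), π₀.1.IsLAlgebraic ∧ (∀ᶠ v : IsDedekindDomain.HeightOneSpectrum ((NumberField.RingOfIntegers K)) in Filter.cofinite,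 Summit.Langlands.SatakeFrobCompatibleAt ι π₀.1 ρ₁ v) ∧ ρ₁.toGaloisRep.IsIrreducible ∧ ρ₁.HasUpperTriangularIntegralModel ρ₁₀ ∧ (∀ (g : Field.absoluteGaloisGroup K) (i : Fin n), (((ρ₁₀ g).val i i - (ρ₀ g).val i i : O)) ∈ IsLocalRing.maximalIdeal O) ∧ (∀ (v : IsDedekindDomain.HeightOneSpectrum ((NumberField.RingOfIntegers K))) (hv : ((p : ℕ) : (NumberField.RingOfIntegers K)) ∈ v.asIdeal), let D := Literature.NumberTheory.PAdicHodge.fontainePstAdicCompletion v p hv; D.IsCrystallineFramed (ρ₁.toLocal v) ∧ (letI := D.algebra; ∀ τ : v.adicCompletion K →ₐ[ℚ_[p]] PadicAlgCl p, ρ₁.labelledHodgeTateWeightsAt v D.algebra D.𝔅 τ.toRingHom = ρ.labelledHodgeTateWeightsAt v D.algebra D.𝔅 τ.toRingHom)) ∧ ∃ r : Literature.NumberTheory.GaloisRepresentations.WeilDeligneRep (v₀.adicCompletion K) (PadicAlgCl p) (Fin n → PadicAlgCl p), Literature.NumberTheory.GaloisRepresentations.IsWeilDeligneOfLadic (ρ₁.toLocal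 v₀).toWeilGroupHom r ∧ r.N ^ (n - 1) ≠ 0) → ∃ π : Literature.NumberTheory.Automorphic.CuspidalAutomorphicRepData n K hcpt, π.1.IsLAlgebraic ∧ ∀ᶠ v : IsDedekindDomain.HeightOneSpectrum ((NumberField.RingOfIntegers K)) in Filter.cofinite, Summit.Langlands.SatakeFrobCompatibleAt ι π.1 ρ v

/-- item stmt-Langlands-18370 · crux · rank 3 · open · by planner
why it might fail: Eisenstein congruences in a PRESCRIBED regular weight with a Steinberg place are known only for GL₂ (Ribet, Berger2009 needs p | L-value); for general (χ̄_i) the boundary class may not lift to a cuspidal one of the same weight; keeping p unramified in K' restricts the SW-style base changes.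
sources: Berger2009, SkinnerWiles1999, arXiv:2607.11763, Harder1987, Ribet1976, ArthurClozelAMS120
[crux] THE ENTRANCE (Ribet/Skinner–Wiles step for GL_n over CM): for ρ in the sector there is a
finite Galois extension K'/K with soluble Galois group, K' CM, p unramified in K', such that ρ|K' is
still irreducible and in the sector (a.e. unramified, residually upper-triangular integral model
ρ₀', crystalline Fontaine–Laffaille with distinct labelled weights), together with a place v₀ ∤ p of
K' where ρ|K' is unramified and a cuspidal seed over K' exactly as in EisensteinSeededLifting
(cuspidal L-algebraic π₀ on GL_n(𝔸_K'), irreducible avatar ρ₁ with the same residual diagonal as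
ρ₀', same labelled weights as ρ|K', Steinberg type at v₀). Intended proof: Chebotarev set-up (v₀
with q ≡ 1 mod p and ρ̄(Frob) unipotent, soluble CM base change keeping p unramified), then an
Eisenstein-to-cuspidal congruence Steinberg at v₀ in the weight of ρ — level raising from the
Borel–Serre boundary (torsion Eisenstein classes, AHTW §5.3; Harder's Eisenstein cohomology;
Berger2009 for n = 2 imaginary quadratic; automorphic induction of characters for cyclically-shaped
diagonals). [difficulty: XL] -/
@[route_item "route-Langlands-EisensteinDegreeShift", crux]
def EisensteinSteinbergSeed : Prop :=
  ∀ (K : Type) [Field K] [NumberField K], NumberField.IsCMField K → ∀ (n : ℕ), 2 ≤ n → ∀ (p : ℕ) [Fact p.Prime], n < p → (∀ v : IsDedekindDomain.HeightOneSpectrum ((NumberField.RingOfIntegers K)), ((p : ℕ) : (NumberField.RingOfIntegers K)) ∈ v.asIdeal → ¬ v.asIdeal ^ 2 ∣ Ideal.span {((p : ℕ) : (NumberField.RingOfIntegers K))}) → ∀ (O : ValuationSubring (PadicAlgCl p)), O = (Valued.v : Valuation (PadicAlgCl p) NNReal).valuationSubring → ∀ (ι : PadicAlgCl p ≃+* ℂ)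 (ρ : Literature.NumberTheory.GaloisRepresentations.FramedGaloisRep K (PadicAlgCl p) n) (ρ₀ : Field.absoluteGaloisGroup K →* GL (Fin n) O), ρ.toGaloisRep.IsIrreducible → (∀ᶠ v : IsDedekindDomain.HeightOneSpectrum ((NumberField.RingOfIntegers K)) in Filter.cofinite, ρ.IsUnramifiedAt v) → ρ.HasUpperTriangularIntegralModel ρ₀ → (∀ (v : IsDedekindDomain.HeightOneSpectrum ((NumberField.RingOfIntegers K))) (hv : ((p : ℕ) : (NumberField.RingOfIntegers K)) ∈ v.asIdeal), let D := Literature.NumberTheory.PAdicHodge.fontainePstAdicCompletion v p hv; D.IsCrystallineFramed (ρ.toLocal v) ∧ (letI := D.algebra; ∀ τ : v.adicCompletion K →ₐ[ℚ_[p]] PadicAlgCl p, let M := ρ.labelledHodgeTateWeightsAt v D.algebra D.𝔅 τ.toRingHom; M.Nodup ∧ Multiset.card M = n ∧ ∀ a ∈ M, ∀ b ∈ M, a - b ≤ (p : ℤ) - 2)) → ∃ (K' : Type) (_ : Field K') (_ : NumberField K') (_ : Algebra K K'), IsGalois K K' ∧ IsSolvable (K' ≃ₐ[K] K') ∧ NumberField.IsCMField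 K' ∧ (∀ w : IsDedekindDomain.HeightOneSpectrum ((NumberField.RingOfIntegers K')), ((p : ℕ) : (NumberField.RingOfIntegers K')) ∈ w.asIdeal → ¬ w.asIdeal ^ 2 ∣ Ideal.span {((p : ℕ) : (NumberField.RingOfIntegers K'))}) ∧ ∃ (ρ₀' : Field.absoluteGaloisGroup K' →* GL (Fin n) O), (ρ.restrictField K').toGaloisRep.IsIrreducible ∧ (∀ᶠ v : IsDedekindDomain.HeightOneSpectrum ((NumberField.RingOfIntegers K')) in Filter.cofinite, (ρ.restrictField K').IsUnramifiedAt v) ∧ (ρ.restrictField K').HasUpperTriangularIntegralModel ρ₀' ∧ (∀ (v : IsDedekindDomain.HeightOneSpectrum ((NumberField.RingOfIntegers K'))) (hv : ((p : ℕ) : (NumberField.RingOfIntegers K')) ∈ v.asIdeal), let D := Literature.NumberTheory.PAdicHodge.fontainePstAdicCompletion v p hv; D.IsCrystallineFramed ((ρ.restrictField K').toLocal v) ∧ (letI := D.algebra; ∀ τ : v.adicCompletion K' →ₐ[ℚ_[p]] PadicAlgCl p, let M := (ρ.restrictField K').labelledHodgeTateWeightsAt v D.algebra D.𝔅 τ.toRingHom;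 M.Nodup ∧ Multiset.card M = n ∧ ∀ a ∈ M, ∀ b ∈ M, a - b ≤ (p : ℤ) - 2)) ∧ ∃ v₀ : IsDedekindDomain.HeightOneSpectrum ((NumberField.RingOfIntegers K')), ((p : ℕ) : (NumberField.RingOfIntegers K')) ∉ v₀.asIdeal ∧ (ρ.restrictField K').IsUnramifiedAt v₀ ∧ ∃ (hcpt' : Literature.NumberTheory.Automorphic.isCompact_glFiniteIntegralLevel n K') (π₀ : Literature.NumberTheory.Automorphic.CuspidalAutomorphicRepData n K' hcpt') (ρ₁ : Literature.NumberTheory.GaloisRepresentations.FramedGaloisRep K' (PadicAlgCl p) n) (ρ₁₀ : Field.absoluteGaloisGroup K' →* GL (Fin n) O), π₀.1.IsLAlgebraic ∧ (∀ᶠ v : IsDedekindDomain.HeightOneSpectrum ((NumberField.RingOfIntegers K')) in Filter.cofinite, Summit.Langlands.SatakeFrobCompatibleAt ι π₀.1 ρ₁ v) ∧ ρ₁.toGaloisRep.IsIrreducible ∧ ρ₁.HasUpperTriangularIntegralModel ρ₁₀ ∧ (∀ (g : Field.absoluteGaloisGroup K') (i : Fin n), (((ρ₁₀ g).val i i - (ρ₀'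 g).val i i : O)) ∈ IsLocalRing.maximalIdeal O) ∧ (∀ (v : IsDedekindDomain.HeightOneSpectrum ((NumberField.RingOfIntegers K'))) (hv : ((p : ℕ) : (NumberField.RingOfIntegers K')) ∈ v.asIdeal), let D := Literature.NumberTheory.PAdicHodge.fontainePstAdicCompletion v p hv; D.IsCrystallineFramed (ρ₁.toLocal v) ∧ (letI := D.algebra; ∀ τ : v.adicCompletion K' →ₐ[ℚ_[p]] PadicAlgCl p, ρ₁.labelledHodgeTateWeightsAt v D.algebra D.𝔅 τ.toRingHom = (ρ.restrictField K').labelledHodgeTateWeightsAt v D.algebra D.𝔅 τ.toRingHom)) ∧ ∃ r : Literature.NumberTheory.GaloisRepresentations.WeilDeligneRep (v₀.adicCompletion K') (PadicAlgCl p) (Fin n → PadicAlgCl p), Literature.NumberTheory.GaloisRepresentations.IsWeilDeligneOfLadic (ρ₁.toLocal v₀).toWeilGroupHom r ∧ r.N ^ (n - 1) ≠ 0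

/-- item stmt-Langlands-18372 · crux · rank 9 · open · by planner
why it might fail: It IS global Langlands reciprocity for GL_n outside one sector (BuzzardGeeLMS2014 Conj. 3.2.1/3.2.2, FontaineMazurGeometric1995 Conj. 1): even Galois representations, irregular π, non-CM fields are all inside it; declared residual, graders judge S1/S2.
sources: BuzzardGeeLMS2014, FontaineMazurGeometric1995, arXiv:2607.11763
[crux] THE REST OF THE SUMMIT along this line (declared RESIDUAL junction, sector convention of
DyadicOddResidue / FifteenLocusEisenstein / SkinnerWilesDefectOne): BorelFLReciprocity → Langlands —
direction (A) entirely, local–global compatibility at every finite place, direction (B) off the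
sector (residually irreducible ρ̄, ordinary/non-FL weights, p ramified or small, n ≥ p, non-CM
fields, irregular weights), the reciprocity data. Conjecture-grade, implied by the summit (probe: S
→ SectorComplement holds), never staffed from this route. [deps: BorelFLReciprocity] [difficulty:
open-problem] -/
@[route_item "route-Langlands-EisensteinDegreeShift", crux]
def SectorComplement : Prop :=
  BorelFLReciprocity → _root_.Langlands

/-- item stmt-Langlands-18371 · support · rank 9 · open · by planner
sources: ArthurClozelAMS120, arXiv:1812.09999, BarnetlambEtAl2014, HarrisLanTaylorThorneRMS2016
[support] Soluble descent given the Galois representation (printed: Arthur–Clozel cyclic base change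
+ strong multiplicity one + Chebotarev, the BLGGT/ACC+ descent lemma): K'/K finite Galois with
soluble group, K and K' CM, ρ : Γ_K → GL_n(ℚ̄_p) irreducible with ρ|K' irreducible and
Satake–Frobenius compatible a.e. with an L-algebraic cuspidal π' of GL_n(𝔸_K') ⟹ ρ is
Satake–Frobenius compatible a.e. with an L-algebraic cuspidal π of GL_n(𝔸_K). Every intermediate
field is CM (complex conjugation is central in Aut of a CM field), so HLTT representations exist
along the tower. [difficulty: L] -/
@[route_item "route-Langlands-EisensteinDegreeShift", crux]
def SolubleDescentGLn : Prop :=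
  ∀ (K : Type) [Field K] [NumberField K] (K' : Type) [Field K'] [NumberField K'] [Algebra K K'], IsGalois K K' → IsSolvable (K' ≃ₐ[K] K') → NumberField.IsCMField K → NumberField.IsCMField K' → ∀ (n : ℕ) (p : ℕ) [Fact p.Prime] (hcpt : Literature.NumberTheory.Automorphic.isCompact_glFiniteIntegralLevel n K) (hcpt' : Literature.NumberTheory.Automorphic.isCompact_glFiniteIntegralLevel n K') (ι : PadicAlgCl p ≃+* ℂ) (ρ : Literature.NumberTheory.GaloisRepresentations.FramedGaloisRep K (PadicAlgCl p) n), ρ.toGaloisRep.IsIrreducible → (ρ.restrictField K').toGaloisRep.IsIrreducible → (∃ π : Literature.NumberTheory.Automorphic.CuspidalAutomorphicRepData n K' hcpt', π.1.IsLAlgebraic ∧ ∀ᶠ v : IsDedekindDomain.HeightOneSpectrum ((NumberField.RingOfIntegers K')) in Filter.cofinite, Summit.Langlands.SatakeFrobCompatibleAt ι π.1 (ρ.restrictField K') v) → ∃ π : Literature.NumberTheory.Automorphic.CuspidalAutomorphicRepData n K hcpt, π.1.IsLAlgebraic ∧ ∀ᶠ v : IsDedekindDomain.HeightOneSpectrum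 ((NumberField.RingOfIntegers K)) in Filter.cofinite, Summit.Langlands.SatakeFrobCompatibleAt ι π.1 ρ v

/-- item stmt-Langlands-18373 · assembly · rank 1 · open · by planner
sources: arXiv:2607.11763, SkinnerWiles1999
[assembly] EisensteinSteinbergSeed → EisensteinSeededLifting → SolubleDescentGLn → SectorComplement
→ Langlands (the type of the deciding theorem `closes`; the target is derived inline from S1, S2, S3
and the junction carries it to the summit). -/
@[route_item "route-Langlands-EisensteinDegreeShift"]
def Assembly : Prop :=
  EisensteinSteinbergSeed → EisensteinSeededLifting → SolubleDescentGLn → SectorComplement → _root_.Langlands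

/-! D-0027 §2.1 — DECIDING THEOREM (planner-authored via `route open/edit --closes-file`; by planner-plan-lens3-Langlands-oqh-g3-0 2026-08-17T15:10:04Z):
its hypotheses are this route's items and its conclusion the sub-problem Statement (glue_lint), and it elaborates with this file. -/

@[closes "route-Langlands-EisensteinDegreeShift"] theorem closes (h₁ : EisensteinSteinbergSeed) (h₂ : EisensteinSeededLifting) (h₃ : SolubleDescentGLn)
    (hC : SectorComplement) : _root_.Langlands := by
  -- the route's Assembly item (S1 → S2 → S3 → junction → summit), proved here from the target derivation
  have hA : Assembly := by
    intro k₁ k₂ k₃ kC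
    refine kC ?_
    intro K _ _ hK n hn p _ hp hur O hO hcpt ι ρ ρ₀ hirr hae hut hFL
    obtain ⟨K', _, _, _, hgal, hsol, hK', hur', ρ₀', hirr', hae', hut', hFL', v₀, hv₀p, hunr, hcpt', hcore⟩ :=
      k₁ K hK n hn p hp hur O hO ι ρ ρ₀ hirr hae hut hFL
    exact k₃ K K' hgal hsol hK hK' n p hcpt hcpt' ι ρ hirr hirr'
      (k₂ K' hK' n hn p hp hur' O hO hcpt' ι (ρ.restrictField K') ρ₀' hirr' hae' hut' hFL' ⟨v₀, hv₀p, hunr, hcore⟩)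
  exact hA h₁ h₂ h₃ hC

end Summit.Langlands.Langlands.Theses.EisensteinDegreeShift
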